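import Summits.HubbardSuperconductivity.HubbardSuperconductivity.Theorems.AnisotropyChordTransferFibre3FinXDCheck

/-!
# Route `AnisotropyChord` / H0 rotor rung: FIN per-`L` row-D (KT-2a″) cell facts, `L = 10`, cells 5–9

Kernel facts `xdCellAny0 10 (49/50) la lb aD = true` (in-kernel point tables, zero data; `decide +kernel`) for the combined-cell
grid of `L = 10` (g5 design, 1–2.5 % cells); assembled in `…FinXDTen`.  Prover seat `hubbard-h0-rotor-p3` g7; helper for piece A =
stmt-HubbardSuperconductivity-23918 of rung 19089 (`--supports`, helper class).  WHAT THIS IS NOT: nothing here proves superconductivity in the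
Hubbard model (rotor TARGET as worded stays FALSE, g15 verdict); kernel facts for ONE hypothesis of ONE conditional reduction.  No sorry.
-/

set_option linter.dupNamespace false
set_option autoImplicit false

namespace Summit.HubbardSuperconductivity.HubbardSuperconductivity.Theorems.AnisotropyChord.Transfer.Fibre3

namespace FinXD

/-- cell 5 of `L = 10` (`hi`). [folklore] -/
theorem xd10_5 : xdCellAny0 10 (49/50 : ℚ) 691900539043845 743751687904768 (1 : ℚ) = true := by decide +kernel

/-- cell 6 of `L = 10` (`hi`). [folklore] -/
theorem xd10_6 : xdCellAny0 10 (49/50 : ℚ) 743751687904768 775867601627916 (1 : ℚ) = true := by decide +kernel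

/-- cell 7 of `L = 10` (`hi`). [folklore] -/
theorem xd10_7 : xdCellAny0 10 (49/50 : ℚ) 775867601627916 795760478398758 (1 : ℚ) = true := by decide +kernel

/-- cell 8 of `L = 10` (`hi`). [folklore] -/
theorem xd10_8 : xdCellAny0 10 (49/50 : ℚ) 795760478398758 808082570449128 (1 : ℚ) = true := by decide +kernel

/-- cell 9 of `L = 10` (`hi`). [folklore] -/
theorem xd10_9 : xdCellAny0 10 (49/50 : ℚ) 808082570449128 815715253333916 (1 : ℚ) = true := by decide +kernel

end FinXD

end Summit.HubbardSuperconductivity.HubbardSuperconductivity.Theorems.AnisotropyChord.Transfer.Fibre3
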